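import Summits.Ventures.PercRepro.SixFourResidueThreeGeneric

/-!
# PercRepro — C-025 at `(6,4)`: Theorem G₃ for EVERY `g`, modulo the per-pair inequality (p2, gen 9 — §21.13.3 / §21.16)

The `t = 3` generic case without any size cap: for a GENERIC solid (`X₂ = 0`) the `J₃` identity and the price
rearrangement of §21.16 hold for every `g`, with the prices as functions `y₃_P(g) = F₃(g)/C(g,2)`,
`y₃_m(g) = [y₃_P·C(m,2) + bonus₃(m) + ε(m)·C(g − m, 2)]/(g − m)` (`yP3`, `yPrice3`, `price_identity3`).  On a rank-`3`
plane trace `ρ` with `p` points the certificate is ADDITIVE over the lines of `ρ` (2-point lines included):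
`Σ_λ y₃_{m_λ}(p − m_λ) − cost₃_g(ρ) − Σ_λ ε(m_λ)C(p − m_λ, 2) = Σ_λ L₃(g,p,m_λ) − base₃(g,p)` (`Lterm3`, `base3`), and since
`Σ_λ C(m_λ, 2) = C(p,2)` it is `≥ 0` as soon as the PER-PAIR inequality `C(p,2)·L₃(g,p,m) ≥ C(m,2)·base₃(g,p)` holds
for every line size `2 ≤ m ≤ p − 1` (`PerPair3`, `cert_plane_of_perPair`).  Summing over the planes with §22.3
(`sum_inc_mul_eq`, now for every `m`) and §22.2 gives

  `J_three_nonneg_of_generic_of_perPair : Generic M G → (∀ p m, 3 ≤ p → p + 3 ≤ g → 2 ≤ m → m < p → PerPair3 g p m) → 0 ≤ J₃(G)`.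

mine-2's §21.16: `PerPair3 g p m` holds for every `11 ≤ g ≤ 100` (exact table) and for `g ≥ 101` (two regimes); at
`g = 10` it fails only for `(p, m) = (7, 2)` (the plane `U_{3,7}`, §21.16's remark).  Those are the remaining
obligations of Theorem G₃; this file reduces the generic case to them.
-/

namespace PercRepro.SixFour

/-! ## The prices as functions of `g` -/

/-- `y₃_P(g) = F₃(g)/C(g,2)`. -/
noncomputable def yP3 (g : ℕ) : ℚ := F3 g / (g.choose 2 : ℚ)

/-- `y₃_m(g) = [y₃_P(g)·C(m,2) + bonus₃(m) + ε(m)·C(g − m, 2)]/(g − m)`. -/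
noncomputable def yPrice3 (g m : ℕ) : ℚ :=
  (yP3 g * (m.choose 2 : ℚ) + bonus3 m + (eps m : ℚ) * ((g - m).choose 2 : ℚ)) / ((g - m : ℕ) : ℚ)

/-- The price identity, for `m < g`. -/
theorem price_identity3 {g m : ℕ} (hm : m < g) :
    yPrice3 g m * ((g - m : ℕ) : ℚ) = yP3 g * (m.choose 2 : ℚ) + bonus3 m + (eps m : ℚ) * ((g - m).choose 2 : ℚ) := by
  unfold yPrice3
  have h : ((g - m : ℕ) : ℚ) ≠ 0 := by
    have : 0 < g - m := by omega
    positivity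
  field_simp

/-- `F₃(g) = y₃_P(g)·C(g,2)` for `g ≥ 2`. -/
theorem F3_eq_yP3 {g : ℕ} (hg : 2 ≤ g) : F3 g = yP3 g * (g.choose 2 : ℚ) := by
  unfold yP3
  have h : (g.choose 2 : ℚ) ≠ 0 := by
    have : 0 < g.choose 2 := Nat.choose_pos hg
    positivity
  field_simp

/-- `y₃_0 = 0`. -/
theorem yPrice3_zero (g : ℕ) : yPrice3 g 0 = 0 := by
  simp [yPrice3, bonus3, eps, delta]

/-- `y₃_1 = 0`. -/
theorem yPrice3_one (g : ℕ) : yPrice3 g 1 = 0 := by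
  simp [yPrice3, bonus3, eps, delta]

/-! ## The additive certificate -/

/-- `L₃(g,p,m) = y₃_m(p − m) + (9/5 + (3/2)(g − p))·δ(m) − (12/5)·C(m,4) − ε(m)·C(p − m, 2)`. -/
noncomputable def Lterm3 (g p m : ℕ) : ℚ :=
  yPrice3 g m * ((p - m : ℕ) : ℚ) + (9 / 5 + 3 / 2 * ((g : ℚ) - p)) * (delta m : ℚ) - 12 / 5 * (m.choose 4 : ℚ) -
    (eps m : ℚ) * ((p - m).choose 2 : ℚ)

/-- `base₃(g,p) = (9/5 + (3/2)(g − p))·δ(p) − (12/5)·C(p,4)`. -/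
noncomputable def base3 (g p : ℕ) : ℚ :=
  (9 / 5 + 3 / 2 * ((g : ℚ) - p)) * (delta p : ℚ) - 12 / 5 * (p.choose 4 : ℚ)

/-- **The per-pair inequality at `t = 3`**: `C(m,2)·base₃(g,p) ≤ C(p,2)·L₃(g,p,m)`. -/
def PerPair3 (g p m : ℕ) : Prop := (m.choose 2 : ℚ) * base3 g p ≤ (p.choose 2 : ℚ) * Lterm3 g p m

/-- `L₃(g,p,m) = 0` for `m ≤ 1`. -/
theorem Lterm3_eq_zero_of_le_one (g p : ℕ) {m : ℕ} (hm : m ≤ 1) : Lterm3 g p m = 0 := by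
  interval_cases m
  · simp [Lterm3, yPrice3_zero, delta, eps]
  · simp [Lterm3, yPrice3_one, delta, eps]

/-- `PerPair3` holds trivially for `m ≤ 1`. -/
theorem perPair3_of_le_one (g p : ℕ) {m : ℕ} (hm : m ≤ 1) : PerPair3 g p m := by
  unfold PerPair3
  rw [Lterm3_eq_zero_of_le_one g p hm]
  interval_cases m <;> simp

open Finset ThmH

variable {α : Type*} [DecidableEq α] {M : Matroid α} [M.Finite] {G : Finset α}

/-- `r₃(ρ,4) + Σ_λ C(m_λ, 4) = C(p, 4)` for every rank-`3` trace (the `4`-subsets have rank `3` or `2`). -/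
theorem r34_add_sum_choose_four (hs : Simple M) (hG : G ⊆ gr M) {P : Finset α}
    (hr : M.eRk ((P ∩ G : Finset α) : Set α) = 3) :
    r34 M G P + ∑ L ∈ lines M, (L ∩ (P ∩ G)).card.choose 4 = (P ∩ G).card.choose 4 := by
  set ρ := P ∩ G with hρdef
  have hρ : ρ ⊆ gr M := Finset.inter_subset_right.trans hG
  have hsplit := Finset.card_filter_add_card_filter_not (s := ρ.powersetCard 4)
    (fun Z : Finset α => M.eRk (Z : Set α) = 3)
  have hcongr : (ρ.powersetCard 4).filter (fun Z : Finset α => ¬ M.eRk (Z : Set α) = 3) =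
      (ρ.powersetCard 4).filter (fun Z : Finset α => M.eRk (Z : Set α) = 2) := by
    refine Finset.filter_congr (fun Z hZ => ?_)
    obtain ⟨hZρ, hc⟩ := Finset.mem_powersetCard.1 hZ
    have hle : M.eRk (Z : Set α) ≤ 3 := by rw [← hr]; exact M.eRk_mono (Finset.coe_subset.2 hZρ)
    constructor
    · intro hne
      refine le_antisymm ?_ (two_le_eRk_of_two_le_card hs hρ hZρ (by omega))
      by_contra h
      exact hne (eRk_eq_of_le_of_not_le (n := 2) hle h)
    · intro h2; rw [h2]; decide
  rw [hcongr, card_rank_two_subsets hs hρ (by norm_num : 2 ≤ 4), Finset.card_powersetCard] at hsplit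
  exact hsplit

/-- No line meets a finset `ρ` in more than `|ρ|` points. -/
theorem inc_eq_zero_of_card_lt (ρ : Finset α) {n : ℕ} (hn : ρ.card < n) : inc M ρ n = 0 := by
  unfold inc
  rw [Finset.card_eq_zero, Finset.filter_eq_empty_iff]
  intro L _ hL
  have := Finset.card_le_card (Finset.inter_subset_right (s₁ := L) (s₂ := ρ))
  omega

/-- The right side of the additive certificate for the plane `P`: `Σ_λ y₃_{m_λ}·(p − m_λ)`. -/
noncomputable def certRHS3 (M : Matroid α) [M.Finite] (G P : Finset α) (g : ℕ) : ℚ :=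
  ∑ L ∈ lines M, yPrice3 g (L ∩ (P ∩ G)).card * (((P ∩ G).card - (L ∩ (P ∩ G)).card : ℕ) : ℚ)

/-- **The additive certificate on a rank-`3` plane trace**: if the per-pair inequality holds for every line size
`2 ≤ m < p`, then `cost₃_g(P) + lppCredit(P) ≤ Σ_λ y₃_{m_λ}(p − m_λ)`. -/
theorem cert_plane_of_perPair (hs : Simple M) (hG : G ⊆ gr M) {P : Finset α}
    (hr : M.eRk ((P ∩ G : Finset α) : Set α) = 3)
    (hpp : ∀ m, 2 ≤ m → m < (P ∩ G).card → PerPair3 G.card (P ∩ G).card m) :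
    cost3 M G P + (lppCredit M G P : ℚ) ≤ certRHS3 M G P G.card := by
  set ρ := P ∩ G with hρdef
  have hρ : ρ ⊆ gr M := Finset.inter_subset_right.trans hG
  have hp3 : 3 ≤ ρ.card := three_le_card_of_eRk_eq_three hr
  -- the line sizes are `< p` (a line containing the whole trace would have rank `2`) and `≤ p`
  have hlt : ∀ L ∈ lines M, (L ∩ ρ).card < ρ.card := by
    intro L hL
    have hle : (L ∩ ρ).card ≤ ρ.card := Finset.card_le_card Finset.inter_subset_right
    rcases Nat.lt_or_ge (L ∩ ρ).card ρ.card with h | h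
    · exact h
    · exfalso
      have heq : L ∩ ρ = ρ := Finset.eq_of_subset_of_card_le Finset.inter_subset_right h
      have hsub : ρ ⊆ L := by rw [← heq]; exact Finset.inter_subset_left
      have h2 := M.eRk_mono (Finset.coe_subset.2 hsub)
      rw [hr, (mem_lines.1 hL).2.2] at h2
      have h32 : (3 : ℕ) ≤ 2 := by exact_mod_cast h2
      omega
  -- per line: `C(p,2)·L₃(m_λ) ≥ C(m_λ,2)·base₃`
  have hterm : ∀ L ∈ lines M,
      ((L ∩ ρ).card.choose 2 : ℚ) * base3 G.card ρ.card ≤ (ρ.card.choose 2 : ℚ) * Lterm3 G.card ρ.card (L ∩ ρ).card := by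
    intro L hL
    rcases Nat.lt_or_ge (L ∩ ρ).card 2 with h | h
    · exact perPair3_of_le_one _ _ (by omega)
    · exact hpp _ h (hlt L hL)
  have hsum := Finset.sum_le_sum hterm
  -- `Σ_λ C(m_λ,2) = C(p,2)`
  have hpairs : ∑ L ∈ lines M, ((L ∩ ρ).card.choose 2 : ℚ) = (ρ.card.choose 2 : ℚ) := by
    exact_mod_cast sum_choose_two_trace hs hρ
  rw [← Finset.sum_mul, hpairs, ← Finset.mul_sum] at hsum
  have hC : (0 : ℚ) < (ρ.card.choose 2 : ℚ) := by
    have : 0 < ρ.card.choose 2 := Nat.choose_pos (by omega)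
    exact_mod_cast this
  have hsum' : base3 G.card ρ.card ≤ ∑ L ∈ lines M, Lterm3 G.card ρ.card (L ∩ ρ).card :=
    le_of_mul_le_mul_left hsum hC
  -- the identities for `D₃`, `r₃₄`, `lppCredit` in line-sum form
  have hD : (D3 M G P : ℚ) = (delta ρ.card : ℚ) - ∑ L ∈ lines M, (delta (L ∩ ρ).card : ℚ) := by
    have h := D3_add_sum_delta hs hρ hr
    have h' : (D3 M G P : ℚ) + ∑ L ∈ lines M, (delta (L ∩ ρ).card : ℚ) = (delta ρ.card : ℚ) := by
      unfold D3
      exact_mod_cast h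
    linarith
  have hR : (r34 M G P : ℚ) = (ρ.card.choose 4 : ℚ) - ∑ L ∈ lines M, ((L ∩ ρ).card.choose 4 : ℚ) := by
    have h := r34_add_sum_choose_four hs hG hr
    have h' : (r34 M G P : ℚ) + ∑ L ∈ lines M, ((L ∩ ρ).card.choose 4 : ℚ) = (ρ.card.choose 4 : ℚ) := by
      exact_mod_cast h
    linarith
  have hL : (lppCredit M G P : ℚ) = ∑ L ∈ lines M, ((eps (L ∩ ρ).card : ℚ) * ((ρ.card - (L ∩ ρ).card).choose 2 : ℚ)) := by
    unfold lppCredit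
    push_cast
    rfl
  -- assemble: `certRHS3 − cost₃ − lppCredit = Σ_λ L₃(m_λ) − base₃`
  have hsplit : ∑ L ∈ lines M, Lterm3 G.card ρ.card (L ∩ ρ).card =
      ∑ L ∈ lines M, yPrice3 G.card (L ∩ ρ).card * ((ρ.card - (L ∩ ρ).card : ℕ) : ℚ) +
        (9 / 5 + 3 / 2 * ((G.card : ℚ) - ρ.card)) * ∑ L ∈ lines M, (delta (L ∩ ρ).card : ℚ) -
        12 / 5 * ∑ L ∈ lines M, ((L ∩ ρ).card.choose 4 : ℚ) -
        ∑ L ∈ lines M, ((eps (L ∩ ρ).card : ℚ) * ((ρ.card - (L ∩ ρ).card).choose 2 : ℚ)) := by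
    simp only [Lterm3, Finset.sum_add_distrib, Finset.sum_sub_distrib, Finset.mul_sum]
  have hexp : certRHS3 M G P G.card - cost3 M G P - (lppCredit M G P : ℚ) =
      ∑ L ∈ lines M, Lterm3 G.card ρ.card (L ∩ ρ).card - base3 G.card ρ.card := by
    unfold certRHS3 cost3 base3
    rw [← hρdef, hsplit, hD, hR, hL]
    ring
  linarith

/-- The right side vanishes on a plane whose trace has rank `≠ 3`: a line meeting the trace in `≥ 2` points contains
it (so the factor `p − m_λ` is `0`), and `y₃_0 = y₃_1 = 0`. -/
theorem certRHS3_eq_zero_of_ne (hs : Simple M) (hG : G ⊆ gr M) {P : Finset α} (hP : P ∈ planes M)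
    (hne : ¬ M.eRk ((P ∩ G : Finset α) : Set α) = 3) : certRHS3 M G P G.card = 0 := by
  set ρ := P ∩ G with hρdef
  have hρ : ρ ⊆ gr M := Finset.inter_subset_right.trans hG
  have hle2 : M.eRk (ρ : Set α) ≤ 2 := by
    have hle3 : M.eRk (ρ : Set α) ≤ 3 := by
      rw [← (mem_planes.1 hP).2.2]
      exact M.eRk_mono (Finset.coe_subset.2 Finset.inter_subset_left)
    obtain ⟨n, hn, -⟩ := eRk_eq_nat M ρ
    rw [hn] at hle3 hne ⊢
    have a1 : n ≤ 3 := by exact_mod_cast hle3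
    have a3 : n ≠ 3 := fun h => hne (by rw [h]; rfl)
    exact_mod_cast (show n ≤ 2 by omega)
  unfold certRHS3
  refine Finset.sum_eq_zero (fun L hL => ?_)
  rcases Nat.lt_or_ge (L ∩ ρ).card 2 with h | h
  · interval_cases hm : (L ∩ ρ).card
    · rw [yPrice3_zero, zero_mul]
    · rw [yPrice3_one, zero_mul]
  · -- two points of `ρ` on `L`: `ρ ⊆ cl(two points) = L`
    obtain ⟨a, ha, b, hb, hab⟩ := Finset.one_lt_card.1 (by omega : 1 < (L ∩ ρ).card)
    rw [Finset.mem_inter] at ha hb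
    have hsub2 : ({a, b} : Finset α) ⊆ L := by
      intro z hz
      rw [Finset.mem_insert, Finset.mem_singleton] at hz
      rcases hz with rfl | rfl
      · exact ha.1
      · exact hb.1
    have hr2 : M.eRk (({a, b} : Finset α) : Set α) = 2 :=
      eRk_eq_two_of_subset_line hs hL hsub2 (by rw [Finset.card_pair hab])
    have hcl := closure_eq_of_subset_line hL hsub2 hr2
    have hρL : ρ ⊆ L := by
      -- `ρ` has rank exactly `2`, so `clF ρ` is a line through `a, b`, hence `= L`
      have hsubρ : ({a, b} : Finset α) ⊆ ρ := by
        intro w hw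
        rw [Finset.mem_insert, Finset.mem_singleton] at hw
        rcases hw with rfl | rfl
        · exact ha.2
        · exact hb.2
      have hρ2 : M.eRk (ρ : Set α) = 2 :=
        le_antisymm hle2 (by rw [← hr2]; exact M.eRk_mono (Finset.coe_subset.2 hsubρ))
      obtain ⟨hL', hρcl⟩ := clF_mem_lines hρ hρ2
      have heqL : L = clF M ρ :=
        lines_eq_of_two_mem hs hL hL' ha.1 hb.1 (hρcl ha.2) (hρcl hb.2) hab
      rw [heqL]
      exact hρcl
    have heq : L ∩ ρ = ρ := Finset.inter_eq_right.2 hρL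
    rw [heq, Nat.sub_self, Nat.cast_zero, mul_zero]

/-- `Σ_{P ∈ planes} Σ_λ y₃_{m_λ}(p_P − m_λ) = Σ_{m ≤ g} y₃_m·(g − m)·b_m` (§22.3 for every line size). -/
theorem sum_certRHS3_eq (hs : Simple M) (hG : G ⊆ gr M) :
    ∑ P ∈ planes M, certRHS3 M G P G.card =
      ∑ m ∈ Finset.range (G.card + 1), yPrice3 G.card m * ((G.card - m : ℕ) : ℚ) * (bLines M G m : ℚ) := by
  unfold certRHS3
  -- per plane, the line sum is a profile sum over `m ≤ g`
  have hplane : ∀ P ∈ planes M,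
      ∑ L ∈ lines M, yPrice3 G.card (L ∩ (P ∩ G)).card * (((P ∩ G).card - (L ∩ (P ∩ G)).card : ℕ) : ℚ) =
        ∑ m ∈ Finset.range (G.card + 1), (inc M (P ∩ G) m : ℚ) * (yPrice3 G.card m * (((P ∩ G).card - m : ℕ) : ℚ)) := by
    intro P _
    rw [sum_lines_eq_sum_inc_rat (P ∩ G) (fun m => yPrice3 G.card m * (((P ∩ G).card - m : ℕ) : ℚ))]
    apply Finset.sum_subset
    · intro m hm
      rw [Finset.mem_range] at hm ⊢
      have := Finset.card_le_card (Finset.inter_subset_right (s₁ := P) (s₂ := G))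
      omega
    · intro m hm hm'
      rw [Finset.mem_range] at hm hm'
      rw [inc_eq_zero_of_card_lt (P ∩ G) (by omega), Nat.cast_zero, zero_mul]
  rw [Finset.sum_congr rfl hplane, Finset.sum_comm]
  refine Finset.sum_congr rfl (fun m hm => ?_)
  rw [Finset.mem_range] at hm
  rcases Nat.lt_or_ge m 2 with h2 | h2
  · -- `y₃_0 = y₃_1 = 0`
    interval_cases m
    · simp [yPrice3_zero]
    · simp [yPrice3_one]
  · have h := sum_inc_mul_eq hs hG (m := m) h2
    have h' : ∑ P ∈ planes M, ((inc M (P ∩ G) m * ((P ∩ G).card - m) : ℕ) : ℚ) =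
        ((G.card - m : ℕ) : ℚ) * (bLines M G m : ℚ) := by
      rw [← Nat.cast_sum, h, Nat.cast_mul]
    rw [mul_assoc, ← h', Finset.mul_sum]
    refine Finset.sum_congr rfl (fun P _ => ?_)
    push_cast
    ring

/-- `b_g = 0`: no line contains the whole rank-`4` set `G`. -/
theorem bLines_card_eq_zero (hr : M.eRk (G : Set α) = 4) : bLines M G G.card = 0 := by
  unfold bLines inc
  rw [Finset.card_eq_zero, Finset.filter_eq_empty_iff]
  intro L hL hc
  have heq : L ∩ G = G := Finset.eq_of_subset_of_card_le Finset.inter_subset_right (by omega)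
  have hsub : G ⊆ L := by rw [← heq]; exact Finset.inter_subset_left
  have h := M.eRk_mono (Finset.coe_subset.2 hsub)
  rw [hr, (mem_lines.1 hL).2.2] at h
  have h42 : (4 : ℕ) ≤ 2 := by exact_mod_cast h
  omega

/-- **Theorem G₃ modulo the per-pair inequality**: for a generic rank-`4` set `G ⊆ E` of a simple matroid with
`g ≥ 7` points, `0 ≤ J₃(G)` as soon as `PerPair3 g p m` holds for `3 ≤ p ≤ g − 3`, `2 ≤ m < p`. -/
theorem J_three_nonneg_of_generic_of_perPair (hs : Simple M) (hG : G ⊆ gr M) (hr : M.eRk (G : Set α) = 4)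
    (hgen : Generic M G) (hg : 7 ≤ G.card)
    (hpp : ∀ p m, 3 ≤ p → p + 3 ≤ G.card → 2 ≤ m → m < p → PerPair3 G.card p m) : 0 ≤ J M G 3 := by
  set S := (planes M).filter (fun P : Finset α => M.eRk ((P ∩ G : Finset α) : Set α) = 3) with hS
  -- F1: the identity, with `X₂ = 0`
  have F1 := J_three_identity hs hG hr
  have hX : X2cnt M G = 0 := X2cnt_eq_zero_of_generic hG hr hgen
  -- F2: the cost sum restricted to the rank-`3` planes
  have F2 := sum_cost3_le_filter (M := M) G
  -- F3: the additive certificate summed over `S`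
  have F3 : ∑ P ∈ S, cost3 M G P + ∑ P ∈ S, (lppCredit M G P : ℚ) ≤ ∑ P ∈ S, certRHS3 M G P G.card := by
    rw [← Finset.sum_add_distrib]
    refine Finset.sum_le_sum (fun P hP => ?_)
    obtain ⟨hP, hr3⟩ := Finset.mem_filter.1 hP
    refine cert_plane_of_perPair hs hG hr3 (fun m hm2 hmp => ?_)
    have hp3 := three_le_card_of_eRk_eq_three hr3
    exact hpp _ _ hp3 (card_trace_add_three_le_of_generic hgen hP) hm2 hmp
  -- F4: the right side over `S` is the right side over all planes (it vanishes elsewhere)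
  have F4 : ∑ P ∈ S, certRHS3 M G P G.card = ∑ P ∈ planes M, certRHS3 M G P G.card := by
    rw [hS]
    apply Finset.sum_subset (Finset.filter_subset _ _)
    intro P hP hPS
    rw [Finset.mem_filter, not_and] at hPS
    exact certRHS3_eq_zero_of_ne hs hG hP (hPS hP)
  -- F5 + F6: the right side as the line quantities, with the price identities
  have F56 : ∑ P ∈ planes M, certRHS3 M G P G.card =
      yP3 G.card * ∑ L ∈ lines M, ((L ∩ G).card.choose 2 : ℚ) + ∑ L ∈ lines M, bonus3 (L ∩ G).card +
        ∑ L ∈ lines M, ((eps (L ∩ G).card : ℚ) * ((G.card - (L ∩ G).card).choose 2 : ℚ)) := by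
    rw [sum_certRHS3_eq hs hG]
    rw [sum_lines_eq_sum_inc_rat G (fun m => (m.choose 2 : ℚ)), sum_lines_eq_sum_inc_rat G (fun m => bonus3 m),
      sum_lines_eq_sum_inc_rat G (fun m => (eps m : ℚ) * ((G.card - m).choose 2 : ℚ))]
    rw [Finset.mul_sum, ← Finset.sum_add_distrib, ← Finset.sum_add_distrib]
    refine Finset.sum_congr rfl (fun m hm => ?_)
    rw [Finset.mem_range] at hm
    rcases Nat.lt_or_ge m G.card with hlt | hge
    · rw [price_identity3 hlt]
      unfold bLines
      ring
    · have hm' : m = G.card := by omega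
      subst hm'
      rw [show bLines M G G.card = inc M G G.card from rfl, ← show bLines M G G.card = inc M G G.card from rfl,
        bLines_card_eq_zero hr]
      simp
  -- F7: `Σ_λ C(m_λ,2) = C(g,2)`
  have F7 : ∑ L ∈ lines M, ((L ∩ G).card.choose 2 : ℚ) = (G.card.choose 2 : ℚ) := by
    exact_mod_cast sum_choose_two_trace hs hG
  -- F9: the `lpp` lower bound
  have F9 : ∑ L ∈ lines M, ((eps (L ∩ G).card : ℚ) * ((crossPairs M G L).card : ℚ)) ≤ (lpp M G : ℚ) := by
    have := lpp_ge hs hG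
    have h' : ∑ L ∈ lines M, ((eps (L ∩ G).card : ℚ) * ((crossPairs M G L).card : ℚ)) =
        ((∑ L ∈ lines M, eps (L ∩ G).card * (crossPairs M G L).card : ℕ) : ℚ) := by push_cast; rfl
    rw [h']
    exact_mod_cast this
  -- F10: the lpp credit
  have F10 : ∑ L ∈ lines M, ((eps (L ∩ G).card : ℚ) * ((G.card - (L ∩ G).card).choose 2 : ℚ)) ≤
      ∑ L ∈ lines M, ((eps (L ∩ G).card : ℚ) * ((crossPairs M G L).card : ℚ)) + ∑ P ∈ S, (lppCredit M G P : ℚ) := by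
    have := sum_eps_choose_le hs hG
    rw [← hS] at this
    have h1 : ∑ L ∈ lines M, ((eps (L ∩ G).card : ℚ) * ((G.card - (L ∩ G).card).choose 2 : ℚ)) =
        ((∑ L ∈ lines M, eps (L ∩ G).card * (G.card - (L ∩ G).card).choose 2 : ℕ) : ℚ) := by push_cast; rfl
    have h2 : ∑ L ∈ lines M, ((eps (L ∩ G).card : ℚ) * ((crossPairs M G L).card : ℚ)) =
        ((∑ L ∈ lines M, eps (L ∩ G).card * (crossPairs M G L).card : ℕ) : ℚ) := by push_cast; rfl
    have h3 : ∑ P ∈ S, (lppCredit M G P : ℚ) = ((∑ P ∈ S, lppCredit M G P : ℕ) : ℚ) := by push_cast; rfl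
    rw [h1, h2, h3, ← Nat.cast_add]
    exact_mod_cast this
  -- F11: `F₃(g) = y₃_P·C(g,2)`
  have F11 := F3_eq_yP3 (g := G.card) (by omega)
  rw [F1, hX]
  push_cast
  rw [F7] at F56
  linarith [F2, F3, F4, F56, F9, F10, F11]

end PercRepro.SixFour
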